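import Summits.Ventures.HSemireg.WedgeHankelRecurrenceGaussChebyshevExtremaIff
import Mathlib.Analysis.Convex.Mul

/-!
# Venture HSemireg — **TAYLOR EXPANSION OF THE VIETA POLYNOMIALS AT THE ENDPOINT `x = 2`, IN EVERY COMMUTATIVE RING: `S_n(X + 2) = Σ_{k≤n} C(n+1+k, 2k+1)·X^k` and `C_{n+1}(X + 2) = Σ_{k≤n+1} (C(n+1+k, 2k) + C(n+k, 2k))·X^k`**
# (all Taylor coefficients at `2` are POSITIVE integers — the odd-column binomials; consequences: `S_n(2 + x) = Σ C(n+1+k,2k+1)x^k`, `C_{n+1}(2 + x) = …` for every `x`, and `S_n`, `C_n` are CONVEX on `[2, ∞)`)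

HONEST FRAMING. Part of the Lean index of the computation cell `pub-hsemireg` (seat p10 gen 49, Sunday typer «UNIFORM-IN-n»).  Polynomial algebra over a commutative ring and elementary convexity (Mathlib
`Polynomial.Chebyshev.S ∕ C`, `Polynomial.coeff ∕ comp`, `Nat.choose`, `ConvexOn`); no variety, no cohomology theory, no sheaf, no Ext group and no semiregularity map is constructed here; nothing here says
that HC / HC_CM / HC_AV holds; no Literature fact (unproved `Prop`) is declared or used.  Custodian versions as in `WedgeHankelSiegelIdeal` (1/3).
SOURCES (cited).  T. J. Rivlin, *The Chebyshev Polynomials* (Wiley 1974), §1.5, (1.97)–(1.98) (`T_n^{(k)}(1)`, `U_n^{(k)}(1)`: `U_n^{(k)}(1) = 2^k k!·C(n+1+k, 2k+1)`, the same numbers); J. C. Mason, D. C. Handscomb,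
*Chebyshev Polynomials* (2003), §2.4.5; T. Koshy, *Fibonacci and Lucas Numbers with Applications* (Wiley 2001), Ch. 13 (the shifted Vieta ∕ Morgan-Voyce-type coefficient triangles `C(n+1+k, 2k+1)`).
PROOF TYPED HERE.  Two-step induction on `n` through `S_{n+2}(X+2) = (X+2)·S_{n+1}(X+2) − S_n(X+2)` read coefficientwise (`((X+2)p)_0 = 2p_0`, `((X+2)p)_{k+1} = p_k + 2p_{k+1}`) and Pascal's rule in the
form `C(m+2, j+2) + C(m, j+2) = 2C(m+1, j+2) + C(m, j)`; `C_{n+2} = S_{n+2} − S_n` (N535) with `C(m+2, j+1) = C(m, j+1) + C(m+1, j) + C(m, j)`; the sum forms by `Polynomial.ext` ∕ `coeff_C_mul_X_pow`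
(`C(n+1+k, 2k+1) = 0` for `k > n`); convexity: `x ↦ (x−2)^k` is convex on `[2, ∞)` (Mathlib `convexOn_pow`, translated) and the coefficients are `≥ 0`.
DEDUP DISCLOSURE (`rg -n 'taylor 2|comp \\(X \\+ 2\\)|choose \\(2 \\* k \\+ 1\\)|ConvexOn' Summits/Ventures/HSemireg Literature/Algebra/Polynomial Literature/Analysis/Approximation`, 2026-09-04): Mathlib has the
DERIVATIVE VALUES at `1`, `iterate_derivative_T_eval_one`, `iterate_derivative_U_eval_one(_eq_div ∕ _dvd)` (Rivlin (1.97)–(1.98), products `∏(2l+3)`, `∏((n+1)² − (l+1)²)` — the same information for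
`U_n` in a different normal form; cited, not used); `Literature.Algebra.Polynomial.ChebyshevCoefficientFormulas ∕ ChebyshevExplicitForms` have the power-basis coefficients AT `0`
(`chebyshevS_eq_sum_choose`, `chebyshevU_eq_sum_choose`, …, cited; those modules import all of Mathlib); `…ChebyshevSubmultiplicative.eval_T_real_monotoneOn` and N522 are monotonicity, not convexity;
no Taylor expansion at `±2` (`±1`) and no `ConvexOn` statement for a Chebyshev polynomial in Mathlib or the tree; the Pascal-rule steps are kept as LOCAL `have`s (the gate found
`PercRepro.choose_second_diff` ≡ a stand-alone version — not restated here); 0 hits for the 11 names below.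

WHAT IS IN THE TREE.  N535 `chebyshevC_add_two_eq_S_sub_S`; Mathlib `S_add_two`, `S_zero ∕ S_one`, `C_one`, `coeff_X_mul`, `coeff_X_mul_zero`, `coeff_C_mul`, `mul_coeff_zero`, `coeff_C_mul_X_pow`, `finsetSum_coeff`,
`Finset.sum_ite_eq`, `Nat.choose_succ_succ'`, `Nat.choose_eq_zero_of_lt`, `eval_comp`, `eval_finsetSum`, `convexOn_pow`, `ConvexOn.translate_left ∕ subset ∕ smul ∕ add ∕ congr`, `convexOn_const`.
THIS FILE (namespace `Summit.Ventures.HSemireg.Wedge.HankelOuter` continued; CHAINED on N548; 0 definitions):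
* §1314 `coeff_X_add_two_mul_zero`, `coeff_X_add_two_mul_succ`, **`chebyshevS_comp_X_add_two_coeff`** (`(S_n(X+2))_k = C(n+1+k, 2k+1)`),
  **`chebyshevC_comp_X_add_two_coeff`** (`(C_{n+1}(X+2))_k = C(n+1+k, 2k) + C(n+k, 2k)`), **`chebyshevS_comp_X_add_two`**, **`chebyshevC_comp_X_add_two`** (the finite sums), **`chebyshevS_eval_add_two`**,
  **`chebyshevC_eval_add_two`** (`S_n(x+2)`, `C_{n+1}(x+2)` as binomial sums, every commutative ring), `convexOn_sum_mul_sub_two_pow` (nonnegative combinations of `(x−2)^k` are convex on `[2, ∞)`),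
  **`convexOn_chebyshevS_real_Ici_two`**, **`convexOn_chebyshevC_real_Ici_two`** (`S_n`, `C_n` convex on `[2, ∞)`).
CAVEATS.  `n ∈ ℕ`; the `C`-statements are indexed `n + 1` (for `C_0 = 2` the coefficient formula would read `2 = C(0,0) + C(−1,0)`); convexity only on `[2, ∞)` (on `(−∞, −2]` it follows by parity and is
not typed).  Nothing Ext-side.  New names only.
-/

open Module Polynomial
open scoped Matrix Polynomial

namespace Summit.Ventures.HSemireg.Wedge.HankelOuter

/-! ## §1314. Taylor expansion at `x = 2` -/

/-! ### Coefficient bookkeeping -/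

/-- `((X + 2)·p)_0 = 2p_0`. [this file, §1314] -/
theorem coeff_X_add_two_mul_zero {R : Type*} [CommRing R] (p : R[X]) : ((X + 2) * p).coeff 0 = 2 * p.coeff 0 := by
  rw [add_mul, coeff_add, coeff_X_mul_zero, zero_add, coeff_ofNat_mul]

/-- `((X + 2)·p)_{k+1} = p_k + 2p_{k+1}`. [this file, §1314] -/
theorem coeff_X_add_two_mul_succ {R : Type*} [CommRing R] (p : R[X]) (k : ℕ) : ((X + 2) * p).coeff (k + 1) = p.coeff k + 2 * p.coeff (k + 1) := by
  rw [add_mul, coeff_add, coeff_X_mul, coeff_ofNat_mul]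

/-! ### The coefficients of `S_n(X + 2)` and `C_{n+1}(X + 2)` -/

/-- **`(S_n(X+2))_k = C(n+1+k, 2k+1)`** for all `n, k ∈ ℕ`, in every commutative ring (e.g. `S_2(X+2) = X² + 4X + 3`, `S_3(X+2) = X³ + 6X² + 10X + 4`). [Rivlin 1974, (1.98) (equivalent form); this file, §1314] -/
theorem chebyshevS_comp_X_add_two_coeff {R : Type*} [CommRing R] (n k : ℕ) :
    ((Polynomial.Chebyshev.S R (n : ℤ)).comp (X + 2)).coeff k = ((n + 1 + k).choose (2 * k + 1) : R) := by
  induction n using Nat.strong_induction_on generalizing k with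
  | _ n ih =>
    match n, k with
    | 0, k =>
      simp only [Nat.cast_zero, Polynomial.Chebyshev.S_zero, one_comp, coeff_one, zero_add]
      match k with
      | 0 => simp
      | k + 1 => rw [if_neg (by omega), Nat.choose_eq_zero_of_lt (by omega)]; simp
    | 1, k =>
      simp only [Nat.cast_one, Polynomial.Chebyshev.S_one, X_comp]
      match k with
      | 0 => rw [coeff_add, coeff_X_zero, coeff_ofNat_zero]; simp
      | 1 => rw [coeff_add, coeff_X_one, coeff_ofNat_succ]; simp
      | k + 2 => rw [coeff_add, coeff_X, if_neg (by omega), coeff_ofNat_succ, Nat.choose_eq_zero_of_lt (by omega)]; simp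
    | n + 2, k =>
      have hrec : (Polynomial.Chebyshev.S R ((n + 2 : ℕ) : ℤ)).comp (X + 2) =
          (X + 2) * (Polynomial.Chebyshev.S R ((n + 1 : ℕ) : ℤ)).comp (X + 2) - (Polynomial.Chebyshev.S R (n : ℤ)).comp (X + 2) := by
        have h := congrArg (fun p => p.comp (X + 2)) (Polynomial.Chebyshev.S_add_two R (n : ℤ))
        simp only [sub_comp, mul_comp, X_comp] at h
        push_cast
        exact h
      rw [hrec, coeff_sub]
      match k with
      | 0 =>
        rw [coeff_X_add_two_mul_zero, ih (n + 1) (by omega) 0, ih n (by omega) 0]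
        simp
        ring
      | k + 1 =>
        rw [coeff_X_add_two_mul_succ, ih (n + 1) (by omega) k, ih (n + 1) (by omega) (k + 1), ih n (by omega) (k + 1)]
        have h : (n + 2 + k + 2).choose (2 * k + 1 + 2) + (n + 2 + k).choose (2 * k + 1 + 2) = 2 * (n + 2 + k + 1).choose (2 * k + 1 + 2) + (n + 2 + k).choose (2 * k + 1) := by
          have h1 : (n + 2 + k + 2).choose (2 * k + 1 + 2) = (n + 2 + k + 1).choose (2 * k + 1 + 1) + (n + 2 + k + 1).choose (2 * k + 1 + 2) := Nat.choose_succ_succ' (n + 2 + k + 1) (2 * k + 1 + 1)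
          have h2 : (n + 2 + k + 1).choose (2 * k + 1 + 1) = (n + 2 + k).choose (2 * k + 1) + (n + 2 + k).choose (2 * k + 1 + 1) := Nat.choose_succ_succ' (n + 2 + k) (2 * k + 1)
          have h3 : (n + 2 + k + 1).choose (2 * k + 1 + 2) = (n + 2 + k).choose (2 * k + 1 + 1) + (n + 2 + k).choose (2 * k + 1 + 2) := Nat.choose_succ_succ' (n + 2 + k) (2 * k + 1 + 1)
          omega
        have e : ((((n + 2 + k + 2).choose (2 * k + 1 + 2) + (n + 2 + k).choose (2 * k + 1 + 2) : ℕ) : R)) = ((2 * (n + 2 + k + 1).choose (2 * k + 1 + 2) + (n + 2 + k).choose (2 * k + 1) : ℕ) : R) := by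
          rw [h]
        push_cast at e
        rw [show n + 2 + 1 + (k + 1) = n + 2 + k + 2 by ring, show 2 * (k + 1) + 1 = 2 * k + 1 + 2 by ring, show n + 1 + 1 + k = n + 2 + k by ring,
          show n + 1 + 1 + (k + 1) = n + 2 + k + 1 by ring, show n + 1 + (k + 1) = n + 2 + k by ring]
        linear_combination -e

/-- **`(C_{n+1}(X+2))_k = C(n+1+k, 2k) + C(n+k, 2k)`** for all `n, k ∈ ℕ`, in every commutative ring (e.g. `C_2(X+2) = X² + 4X + 2`, `C_3(X+2) = X³ + 6X² + 9X + 2`). [this file, §1314] -/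
theorem chebyshevC_comp_X_add_two_coeff {R : Type*} [CommRing R] (n k : ℕ) :
    ((Polynomial.Chebyshev.C R ((n + 1 : ℕ) : ℤ)).comp (X + 2)).coeff k = ((n + 1 + k).choose (2 * k) + (n + k).choose (2 * k) : R) := by
  match n with
  | 0 =>
    simp only [zero_add, Nat.cast_one, Polynomial.Chebyshev.C_one, X_comp]
    match k with
    | 0 => rw [coeff_add, coeff_X_zero, coeff_ofNat_zero]; norm_num
    | 1 => rw [coeff_add, coeff_X_one, coeff_ofNat_succ]; norm_num
    | k + 2 =>
      rw [coeff_add, coeff_X, if_neg (by omega), coeff_ofNat_succ, Nat.choose_eq_zero_of_lt (by omega), Nat.choose_eq_zero_of_lt (by omega)]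
      simp
  | m + 1 =>
    have hC : (Polynomial.Chebyshev.C R ((m + 1 + 1 : ℕ) : ℤ)).comp (X + 2) = (Polynomial.Chebyshev.S R ((m + 2 : ℕ) : ℤ)).comp (X + 2) - (Polynomial.Chebyshev.S R (m : ℤ)).comp (X + 2) := by
      have h := congrArg (fun p => p.comp (X + 2)) (chebyshevC_add_two_eq_S_sub_S R (m : ℤ))
      simp only [sub_comp] at h
      push_cast at h ⊢
      exact h
    rw [hC, coeff_sub, chebyshevS_comp_X_add_two_coeff, chebyshevS_comp_X_add_two_coeff]
    have h : (m + 1 + k + 2).choose (2 * k + 1) = (m + 1 + k).choose (2 * k + 1) + (m + 1 + k + 1).choose (2 * k) + (m + 1 + k).choose (2 * k) := by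
      have h1 : (m + 1 + k + 2).choose (2 * k + 1) = (m + 1 + k + 1).choose (2 * k) + (m + 1 + k + 1).choose (2 * k + 1) := Nat.choose_succ_succ' (m + 1 + k + 1) (2 * k)
      have h3 : (m + 1 + k + 1).choose (2 * k + 1) = (m + 1 + k).choose (2 * k) + (m + 1 + k).choose (2 * k + 1) := Nat.choose_succ_succ' (m + 1 + k) (2 * k)
      omega
    have e : (((m + 1 + k + 2).choose (2 * k + 1) : ℕ) : R) = (((m + 1 + k).choose (2 * k + 1) + (m + 1 + k + 1).choose (2 * k) + (m + 1 + k).choose (2 * k) : ℕ) : R) := by rw [h]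
    push_cast at e
    rw [show m + 2 + 1 + k = m + 1 + k + 2 by ring, show m + 1 + 1 + k = m + 1 + k + 1 by ring]
    linear_combination e

/-! ### The finite sums -/

/-- **`S_n(X + 2) = Σ_{k≤n} C(n+1+k, 2k+1)·X^k`** in every commutative ring. [this file, §1314] -/
theorem chebyshevS_comp_X_add_two {R : Type*} [CommRing R] (n : ℕ) :
    (Polynomial.Chebyshev.S R (n : ℤ)).comp (X + 2) = ∑ k ∈ Finset.range (n + 1), Polynomial.C (((n + 1 + k).choose (2 * k + 1) : R)) * X ^ k := by
  ext j
  rw [chebyshevS_comp_X_add_two_coeff, finsetSum_coeff]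
  simp only [coeff_C_mul_X_pow]
  rw [Finset.sum_ite_eq]
  split_ifs with hj
  · rfl
  · rw [Finset.mem_range, not_lt] at hj
    rw [Nat.choose_eq_zero_of_lt (by omega), Nat.cast_zero]

/-- **`C_{n+1}(X + 2) = Σ_{k≤n+1} (C(n+1+k, 2k) + C(n+k, 2k))·X^k`** in every commutative ring. [this file, §1314] -/
theorem chebyshevC_comp_X_add_two {R : Type*} [CommRing R] (n : ℕ) :
    (Polynomial.Chebyshev.C R ((n + 1 : ℕ) : ℤ)).comp (X + 2) = ∑ k ∈ Finset.range (n + 2), Polynomial.C (((n + 1 + k).choose (2 * k) + (n + k).choose (2 * k) : R)) * X ^ k := by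
  ext j
  rw [chebyshevC_comp_X_add_two_coeff, finsetSum_coeff]
  simp only [coeff_C_mul_X_pow]
  rw [Finset.sum_ite_eq]
  split_ifs with hj
  · rfl
  · rw [Finset.mem_range, not_lt] at hj
    rw [Nat.choose_eq_zero_of_lt (by omega), Nat.choose_eq_zero_of_lt (by omega), Nat.cast_zero, add_zero]

/-- **`S_n(x + 2) = Σ_{k≤n} C(n+1+k, 2k+1)·x^k`** for every `x` in a commutative ring (in particular `S_n(2) = n + 1`, `S_n′(2) = C(n+2, 3)`, …). [this file, §1314] -/
theorem chebyshevS_eval_add_two {R : Type*} [CommRing R] (n : ℕ) (x : R) :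
    (Polynomial.Chebyshev.S R (n : ℤ)).eval (x + 2) = ∑ k ∈ Finset.range (n + 1), ((n + 1 + k).choose (2 * k + 1) : R) * x ^ k := by
  have h := congrArg (Polynomial.eval x) (chebyshevS_comp_X_add_two (R := R) n)
  rw [eval_comp, eval_add, eval_X, eval_ofNat] at h
  rw [h, eval_finsetSum]
  simp only [eval_mul, eval_C, eval_pow, eval_X]

/-- **`C_{n+1}(x + 2) = Σ_{k≤n+1} (C(n+1+k, 2k) + C(n+k, 2k))·x^k`** for every `x` in a commutative ring. [this file, §1314] -/
theorem chebyshevC_eval_add_two {R : Type*} [CommRing R] (n : ℕ) (x : R) :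
    (Polynomial.Chebyshev.C R ((n + 1 : ℕ) : ℤ)).eval (x + 2) = ∑ k ∈ Finset.range (n + 2), ((n + 1 + k).choose (2 * k) + (n + k).choose (2 * k) : R) * x ^ k := by
  have h := congrArg (Polynomial.eval x) (chebyshevC_comp_X_add_two (R := R) n)
  rw [eval_comp, eval_add, eval_X, eval_ofNat] at h
  rw [h, eval_finsetSum]
  simp only [eval_mul, eval_C, eval_pow, eval_X]

/-! ### Convexity on `[2, ∞)` -/

/-- A combination `Σ_{k<N} c_k (x − 2)^k` with `c_k ≥ 0` is convex on `[2, ∞)`. [this file, §1314] -/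
theorem convexOn_sum_mul_sub_two_pow {c : ℕ → ℝ} (hc : ∀ k, 0 ≤ c k) (N : ℕ) :
    ConvexOn ℝ (Set.Ici (2 : ℝ)) (fun x : ℝ => ∑ k ∈ Finset.range N, c k * (x - 2) ^ k) := by
  have hpow : ∀ k : ℕ, ConvexOn ℝ (Set.Ici (2 : ℝ)) (fun x : ℝ => (x - 2) ^ k) := by
    intro k
    have h := (convexOn_pow k : ConvexOn ℝ (Set.Ici (0 : ℝ)) fun x : ℝ => x ^ k).translate_left (-2)
    refine (h.subset (fun x hx => ?_) (convex_Ici 2)).congr (fun x _ => ?_)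
    · simp only [Set.mem_preimage, Set.mem_Ici] at hx ⊢
      linarith
    · simp only [Function.comp_apply, ← sub_eq_add_neg]
  induction N with
  | zero =>
    simp only [Finset.range_zero, Finset.sum_empty]
    exact convexOn_const 0 (convex_Ici 2)
  | succ M ih =>
    simp only [Finset.sum_range_succ]
    exact ih.add ((hpow M).smul (hc M))

/-- **`S_n` is convex on `[2, ∞)`** (all Taylor coefficients at `2` are `≥ 0`). [this file, §1314] -/
theorem convexOn_chebyshevS_real_Ici_two (n : ℕ) : ConvexOn ℝ (Set.Ici (2 : ℝ)) (fun x : ℝ => (Polynomial.Chebyshev.S ℝ (n : ℤ)).eval x) := by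
  refine (convexOn_sum_mul_sub_two_pow (c := fun k => ((n + 1 + k).choose (2 * k + 1) : ℝ)) (fun k => by positivity) (n + 1)).congr (fun x _ => ?_)
  have h := chebyshevS_eval_add_two (R := ℝ) n (x - 2)
  rw [sub_add_cancel] at h
  exact h.symm

/-- **`C_n` is convex on `[2, ∞)`.** [this file, §1314] -/
theorem convexOn_chebyshevC_real_Ici_two (n : ℕ) : ConvexOn ℝ (Set.Ici (2 : ℝ)) (fun x : ℝ => (Polynomial.Chebyshev.C ℝ (n : ℤ)).eval x) := by
  match n with
  | 0 =>
    simp only [Nat.cast_zero, Polynomial.Chebyshev.C_zero, eval_ofNat]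
    exact convexOn_const 2 (convex_Ici 2)
  | m + 1 =>
    refine (convexOn_sum_mul_sub_two_pow (c := fun k => ((m + 1 + k).choose (2 * k) + (m + k).choose (2 * k) : ℝ)) (fun k => by positivity) (m + 2)).congr (fun x _ => ?_)
    have h := chebyshevC_eval_add_two (R := ℝ) m (x - 2)
    rw [sub_add_cancel] at h
    exact h.symm

end Summit.Ventures.HSemireg.Wedge.HankelOuter
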